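import Literature.Geometry.DiscreteGeometry.SphericalCodeContactGraph
import HarnessLib

/-!
# Azimuths around a unit vector of `ℝ³` at two contact levels: no six directions with pairwise
# tangent angles `> 60°`, no five with pairwise tangent angles `> 72°`

HONEST FRAMING. Part of the venture `Summits/Ventures/Crystal3D` (cell `pub-crystal3d`, phase 2,
24-hour sprint `PLAN.md` R42; seat typer-bulk-2). The linear-algebra engine behind the sharp
degree bounds of the GAP census (`Bulk/GapDegreesSharp.lean`, `DESIGN-L12-THEORY.md` P-L2(b),(c)):
the tree's one-level `no_six_neighbours` (`Literature…SphericalCodeContactGraph`, Musin–Tarasov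
2012 Prop. 3.3 pattern) made TWO-LEVEL. Around a unit vector `v`, unit vectors `u_k` at levels
`κ_k = ⟪v, u_k⟫ ∈ (−1, 1)` have azimuths `θ_k` with
`⟪u_i, u_j⟫ = √(1−κ_i²) √(1−κ_j²) cos(θ_i − θ_j) + κ_i κ_j` (`exists_sorted_azimuths`); six
azimuths with pairwise `cos < 1/2`, or five with pairwise `cos < cos(2π/5) = (√5 − 1)/4`, do not
fit around a circle (`no_six_directions`, `no_five_directions`). Pure linear algebra and
trigonometry; nothing about packings is claimed here.
-/

noncomputable section

open scoped BigOperators InnerProductSpace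
open Finset Real

namespace Summit.Ventures.Crystal3D

open Literature.Geometry.DiscreteGeometry

/-! ## Azimuths around a unit vector (two contact levels) -/

/-- Polar form with two radii: `X X' + Y Y' = √R √R' cos(θ − θ')`. -/
theorem mul_add_mul_eq_sqrt_mul_sqrt_mul_cos {X Y X' Y' R R' : ℝ} (h : X ^ 2 + Y ^ 2 = R)
    (h' : X' ^ 2 + Y' ^ 2 = R') :
    X * X' + Y * Y' =
      √R * √R' * Real.cos (Complex.arg ⟨X, Y⟩ - Complex.arg ⟨X', Y'⟩) := by
  set θ := Complex.arg ⟨X, Y⟩ with hθ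
  set θ' := Complex.arg ⟨X', Y'⟩ with hθ'
  obtain ⟨hX, hY⟩ := eq_sqrt_mul_cos_sin_arg h
  obtain ⟨hX', hY'⟩ := eq_sqrt_mul_cos_sin_arg h'
  rw [← hθ] at hX hY
  rw [← hθ'] at hX' hY'
  rw [Real.cos_sub]
  linear_combination X' * hX + √R * Real.cos θ * hX' + Y' * hY + √R * Real.sin θ * hY'

/-- **Sorted azimuths.** Around a unit vector `v` of `ℝ³`, `n` unit vectors `u_k` at levels
`⟪v, u_k⟫² < 1` whose pairwise TANGENT angles have cosine `< C ≤ 1`, i.e.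
`⟪u_i, u_j⟫ − ⟪v,u_i⟫⟪v,u_j⟫ < C √(1 − ⟪v,u_i⟫²) √(1 − ⟪v,u_j⟫²)`, have `n` strictly sorted
azimuths in `(−π, π]` with pairwise differences of cosine `< C`. -/
theorem exists_sorted_azimuths {v : EuclideanSpace ℝ (Fin 3)} (hv : ‖v‖ = 1) {n : ℕ}
    (u : Fin n → EuclideanSpace ℝ (Fin 3)) (hn : ∀ k, ‖u k‖ = 1)
    (hlev : ∀ k, ⟪v, u k⟫_ℝ ^ 2 < 1) {C : ℝ} (hC1 : C ≤ 1)
    (hsep : ∀ i j, i ≠ j → ⟪u i, u j⟫_ℝ - ⟪v, u i⟫_ℝ * ⟪v, u j⟫_ℝ <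
      C * (√(1 - ⟪v, u i⟫_ℝ ^ 2) * √(1 - ⟪v, u j⟫_ℝ ^ 2))) :
    ∃ t : Fin n → ℝ, StrictMono t ∧ (∀ k, -π < t k) ∧ (∀ k, t k ≤ π) ∧
      ∀ i j, i ≠ j → Real.cos (t i - t j) < C := by
  classical
  obtain ⟨b, hb⟩ := exists_orthonormalBasis_third_eq_unit hv
  -- tangent coordinates and levels
  set X : Fin n → ℝ := fun k => ⟪b 0, u k⟫_ℝ with hXdef
  set Y : Fin n → ℝ := fun k => ⟪b 1, u k⟫_ℝ with hYdef
  have hZ : ∀ k, ⟪b 2, u k⟫_ℝ = ⟪v, u k⟫_ℝ := fun k => by rw [hb]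
  have hXY : ∀ k, X k ^ 2 + Y k ^ 2 = 1 - ⟪v, u k⟫_ℝ ^ 2 := by
    intro k
    have h1 : ⟪u k, u k⟫_ℝ = 1 := by rw [real_inner_self_eq_norm_sq, hn k]; norm_num
    rw [inner_eq_sum_three b, hZ k] at h1
    simp only [hXdef, hYdef]
    nlinarith [h1]
  set θ : Fin n → ℝ := fun k => Complex.arg ⟨X k, Y k⟩ with hθdef
  have hinner : ∀ i j, ⟪u i, u j⟫_ℝ =
      √(1 - ⟪v, u i⟫_ℝ ^ 2) * √(1 - ⟪v, u j⟫_ℝ ^ 2) * Real.cos (θ i - θ j) +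
        ⟪v, u i⟫_ℝ * ⟪v, u j⟫_ℝ := by
    intro i j
    have hcs := mul_add_mul_eq_sqrt_mul_sqrt_mul_cos (hXY i) (hXY j)
    rw [inner_eq_sum_three b, hZ i, hZ j]
    simp only [hθdef]
    linarith [hcs]
  -- pairwise: `cos (θ i - θ j) < C`
  have hC : ∀ i j, i ≠ j → Real.cos (θ i - θ j) < C := by
    intro i j hij
    have h1 := hsep i j hij
    rw [hinner i j] at h1
    have hpos : 0 < √(1 - ⟪v, u i⟫_ℝ ^ 2) * √(1 - ⟪v, u j⟫_ℝ ^ 2) :=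
      mul_pos (Real.sqrt_pos.2 (by linarith [hlev i])) (Real.sqrt_pos.2 (by linarith [hlev j]))
    by_contra hge
    push Not at hge
    have := mul_le_mul_of_nonneg_left hge hpos.le
    linarith
  have hθinj : Function.Injective θ := by
    intro i j hij
    by_contra hne
    have := hC i j hne
    rw [hij, sub_self, Real.cos_zero] at this
    linarith
  -- sort the azimuths
  have hAcard : (univ.image θ).card = n := by
    rw [card_image_of_injective _ hθinj, card_univ, Fintype.card_fin]
  let e := (univ.image θ).orderEmbOfFin hAcard
  have hmem : ∀ k, ∃ i, θ i = e k := by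
    intro k
    have := (univ.image θ).orderEmbOfFin_mem hAcard k
    rw [mem_image] at this
    obtain ⟨i, -, hi⟩ := this
    exact ⟨i, hi⟩
  choose π' hπ' using hmem
  refine ⟨fun k => e k, e.strictMono, ?_, ?_, ?_⟩
  · intro k
    show -π < e k
    rw [← hπ' k]
    exact Complex.neg_pi_lt_arg _
  · intro k
    show e k ≤ π
    rw [← hπ' k]
    exact Complex.arg_le_pi _
  · intro i j hij
    have hne : π' i ≠ π' j := by
      intro h
      apply hij
      apply e.injective
      rw [← hπ' i, ← hπ' j, h]
    show Real.cos (e i - e j) < C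
    rw [← hπ' i, ← hπ' j]
    exact hC _ _ hne

/-- **No six directions** around a unit vector with pairwise tangent angles of cosine `< 1/2`
(two-level form of the tree's `no_six_neighbours`). -/
theorem no_six_directions {v : EuclideanSpace ℝ (Fin 3)} (hv : ‖v‖ = 1)
    (u : Fin 6 → EuclideanSpace ℝ (Fin 3)) (hn : ∀ k, ‖u k‖ = 1) (hlev : ∀ k, ⟪v, u k⟫_ℝ ^ 2 < 1)
    (hsep : ∀ i j, i ≠ j → ⟪u i, u j⟫_ℝ - ⟪v, u i⟫_ℝ * ⟪v, u j⟫_ℝ <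
      1 / 2 * (√(1 - ⟪v, u i⟫_ℝ ^ 2) * √(1 - ⟪v, u j⟫_ℝ ^ 2))) : False := by
  obtain ⟨t, hmono, hlo, hhi, hC⟩ := exists_sorted_azimuths hv u hn hlev (by norm_num) hsep
  exact six_sorted_angles_false t hmono (hlo 0) (hhi 5) hC

/-! ## Five directions: the `2π/5` threshold -/

/-- `cos (2π/5) = (√5 − 1)/4`. -/
theorem cos_two_pi_div_five : Real.cos (2 * π / 5) = (√5 - 1) / 4 := by
  have h : 2 * π / 5 = 2 * (π / 5) := by ring
  rw [h, Real.cos_two_mul, Real.cos_pi_div_five]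
  have h5 : √5 * √5 = 5 := Real.mul_self_sqrt (by norm_num)
  nlinarith [h5]

/-- `cos g < cos (2π/5)` with `g ≥ 0` forces `g > 2π/5`. -/
theorem two_pi_div_five_lt_of_cos_lt {g : ℝ} (h0 : 0 ≤ g)
    (hc : Real.cos g < Real.cos (2 * π / 5)) : 2 * π / 5 < g := by
  by_contra hle
  push Not at hle
  have : Real.cos (2 * π / 5) ≤ Real.cos g :=
    Real.cos_le_cos_of_nonneg_of_le_pi h0 (by linarith [Real.pi_pos]) hle
  linarith

/-- **No five gaps.** Five nonnegative angles summing to `2π` cannot all have cosine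
`< cos (2π/5)`. -/
theorem five_gaps_false (g : Fin 5 → ℝ) (h0 : ∀ k, 0 ≤ g k)
    (hsum : g 0 + g 1 + g 2 + g 3 + g 4 = 2 * π)
    (hc : ∀ k, Real.cos (g k) < Real.cos (2 * π / 5)) : False := by
  have h := fun k => two_pi_div_five_lt_of_cos_lt (h0 k) (hc k)
  have e0 := h 0; have e1 := h 1; have e2 := h 2; have e3 := h 3; have e4 := h 4
  linarith

/-- **No five sorted directions** `−π < t₀ < ⋯ < t₄ ≤ π` with all pairwise differences of cosine
`< cos (2π/5)`. -/
theorem five_sorted_angles_false (t : Fin 5 → ℝ) (hmono : StrictMono t) (hlo : -π < t 0)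
    (hhi : t 4 ≤ π) (hC : ∀ i j, i ≠ j → Real.cos (t i - t j) < Real.cos (2 * π / 5)) :
    False := by
  have h01 : t 0 < t 1 := hmono (by decide)
  have h12 : t 1 < t 2 := hmono (by decide)
  have h23 : t 2 < t 3 := hmono (by decide)
  have h34 : t 3 < t 4 := hmono (by decide)
  have hw : Real.cos (2 * π - (t 4 - t 0)) = Real.cos (t 4 - t 0) := Real.cos_two_pi_sub _
  refine five_gaps_false ![t 1 - t 0, t 2 - t 1, t 3 - t 2, t 4 - t 3, 2 * π - (t 4 - t 0)]
    ?_ ?_ ?_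
  · intro k
    fin_cases k <;> simp <;> linarith
  · simp only [Matrix.cons_val_zero, Matrix.cons_val_one, Matrix.cons_val]
    ring
  · intro k
    fin_cases k
    · simpa using hC 1 0 (by decide)
    · simpa using hC 2 1 (by decide)
    · simpa using hC 3 2 (by decide)
    · simpa using hC 4 3 (by decide)
    · simpa [hw] using hC 4 0 (by decide)

/-- **No five directions** around a unit vector with pairwise tangent angles of cosine
`< cos (2π/5)`. -/
theorem no_five_directions {v : EuclideanSpace ℝ (Fin 3)} (hv : ‖v‖ = 1)
    (u : Fin 5 → EuclideanSpace ℝ (Fin 3)) (hn : ∀ k, ‖u k‖ = 1) (hlev : ∀ k, ⟪v, u k⟫_ℝ ^ 2 < 1)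
    (hsep : ∀ i j, i ≠ j → ⟪u i, u j⟫_ℝ - ⟪v, u i⟫_ℝ * ⟪v, u j⟫_ℝ <
      Real.cos (2 * π / 5) * (√(1 - ⟪v, u i⟫_ℝ ^ 2) * √(1 - ⟪v, u j⟫_ℝ ^ 2))) : False := by
  have hC1 : Real.cos (2 * π / 5) ≤ 1 := Real.cos_le_one _
  obtain ⟨t, hmono, hlo, hhi, hC⟩ := exists_sorted_azimuths hv u hn hlev hC1 hsep
  exact five_sorted_angles_false t hmono (hlo 0) (hhi 4) hC

end Summit.Ventures.Crystal3D

end
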